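import Mathlib.Algebra.Field.Basic
import Mathlib.Tactic.LinearCombination
import Mathlib.Tactic.Ring
import HarnessLib

/-!
# Venture HSemireg — the escape locus `Σ_a` of the total family in closed form

Seat w1-tw-2 of the computation cell `pub-hsemireg` (W1; `widen/W1/BRANCH-CLASSIFICATION-w1tw2.md`,
memo `widen/W1/PSTU-READ-tw2.md` §46 and ADDENDUM 2; companion of w1-tw-1's CC note §26.9 (T18)).

In the branch classification of the points at infinity of the total family `X'` of the stratum-(II)
chart over `u_s = u₀` (Case I), the reductions of the four roots of `P₄` form a size-4 multiset `T` on
which the two NORM CONDITIONS hold: `(∏ T)² = K_b K_c` and `e₂(T²) = -(K_b + K_c)`. The only types that can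
leave a root of `B₀` free are `T = {ω, u₀, r, r}` (and its `ω'`-twin), and `T = {ω, ω', u₀, r}` must be
inconsistent. This file records the field algebra of these two facts:

* `product_factor` / `escape_locus_closed_form` — for `T = {ω, u₀, r, r}` write `X := ω² u₀²`, `R := r²`;
  the norm conditions read `X · R² = K_b K_c` and `X + 2 (ω² + u₀²) R + R² = -(K_b + K_c)`; eliminating
  `R` gives the CLOSED FORM of the escape locus
  `K_a (X + K_b)² (X + K_c)² = 4 K_b K_c · X · (X + K_a)²` (using `ω⁴ = K_a`).
* `escape_locus_member_one` — for the member's index `a = 1` (`K_a = 16`, `ω = 2`, `K_b = 2`,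
  `K_c = -3`, `X = 4u²`) the closed form is `64 · (64u⁸ - 8u⁶ + 148u⁴ + 396u² + 9)` (a ring identity; this
  octic has no root in `𝔽₇₃`).
* `three_constants_type_excluded` — for `T = {ω, ω', u₀, r}` with `ω'² = -ω²`, `ω⁴ = K_a`, the two norm
  conditions force `(K_a - K_b)(K_a - K_c) = 0`, impossible for pairwise distinct parameters.

HONEST FRAMING. Elementary identities in a field; no curve, branch, incidence or semiregularity map is
formalised; nothing here says that HC, HC_CM or HC_AV holds, and nothing here is a new case of anything.
-/

namespace Summit.Ventures.HSemireg

namespace EscapeLocusClosedForm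

variable {F : Type*} [Field F]

/-- Type `{ω, u₀, r, r}`: with `X = ω²u₀²`, `R = r²`, `W = ω² + u₀²`, the norm conditions
`X R² = K_b K_c` and `X + 2 W R + R² = -(K_b + K_c)` give `(X + K_b)(X + K_c) = -(2 W R X)`. -/
theorem product_factor {X R W Kb Kc : F} (h1 : X * R ^ 2 = Kb * Kc)
    (h2 : X + 2 * W * R + R ^ 2 = -(Kb + Kc)) :
    (X + Kb) * (X + Kc) = -(2 * W * R * X) := by
  linear_combination X * h2 - h1

/-- CLOSED FORM of the escape locus (type `{ω, u₀, r, r}`): if `ω⁴ = K_a`, `X = ω²u₀²`, `R = r²` satisfy the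
two norm conditions, then `K_a (X + K_b)² (X + K_c)² = 4 K_b K_c X (X + K_a)²`. -/
theorem escape_locus_closed_form {ω u₀ X R Ka Kb Kc : F} (hω : ω ^ 4 = Ka) (hX : X = ω ^ 2 * u₀ ^ 2)
    (h1 : X * R ^ 2 = Kb * Kc) (h2 : X + 2 * (ω ^ 2 + u₀ ^ 2) * R + R ^ 2 = -(Kb + Kc)) :
    Ka * (X + Kb) ^ 2 * (X + Kc) ^ 2 = 4 * Kb * Kc * X * (X + Ka) ^ 2 := by
  have hP : (X + Kb) * (X + Kc) = -(2 * (ω ^ 2 + u₀ ^ 2) * R * X) := product_factor h1 h2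
  -- square the factorisation, insert `X R² = K_b K_c` and `K_a (ω² + u₀²)² = (X + K_a)²`
  have hsq : (X + Kb) ^ 2 * (X + Kc) ^ 2 = 4 * (ω ^ 2 + u₀ ^ 2) ^ 2 * X * (X * R ^ 2) := by
    linear_combination ((X + Kb) * (X + Kc) - 2 * (ω ^ 2 + u₀ ^ 2) * R * X) * hP
  have hW : Ka * (ω ^ 2 + u₀ ^ 2) ^ 2 = (X + Ka) ^ 2 := by
    rw [hX, ← hω]; ring
  calc Ka * (X + Kb) ^ 2 * (X + Kc) ^ 2
      = Ka * ((X + Kb) ^ 2 * (X + Kc) ^ 2) := by ring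
    _ = Ka * (4 * (ω ^ 2 + u₀ ^ 2) ^ 2 * X * (X * R ^ 2)) := by rw [hsq]
    _ = 4 * (X * R ^ 2) * X * (Ka * (ω ^ 2 + u₀ ^ 2) ^ 2) := by ring
    _ = 4 * (Kb * Kc) * X * (X + Ka) ^ 2 := by rw [h1, hW]
    _ = 4 * Kb * Kc * X * (X + Ka) ^ 2 := by ring

/-- The member's index `a = 1`: `K_a = 16`, `ω = 2` (so `X = 4u²`), `(K_b, K_c) = (2, -3)`; the closed form
is `64` times the octic `64u⁸ - 8u⁶ + 148u⁴ + 396u² + 9`. -/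
theorem escape_locus_member_one (u : F) :
    16 * (4 * u ^ 2 + 2) ^ 2 * (4 * u ^ 2 + (-3)) ^ 2 - 4 * 2 * (-3) * (4 * u ^ 2) * (4 * u ^ 2 + 16) ^ 2
      = 64 * (64 * u ^ 8 - 8 * u ^ 6 + 148 * u ^ 4 + 396 * u ^ 2 + 9) := by
  ring

/-- Type `{ω, ω', u₀, r}` — the second norm condition: with `ω'² = -ω²` and `ω⁴ = K_a`,
`e₂({ω², ω'², u₀², r²}) = -(K_b + K_c)` reads `u₀² r² = K_a - K_b - K_c`. -/
theorem three_constants_type_e2 {ω ω' u₀ r Ka Kb Kc : F} (hω : ω ^ 4 = Ka) (hω' : ω' ^ 2 = -ω ^ 2)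
    (N2 : ω ^ 2 * ω' ^ 2 + ω ^ 2 * u₀ ^ 2 + ω ^ 2 * r ^ 2 + ω' ^ 2 * u₀ ^ 2 + ω' ^ 2 * r ^ 2
      + u₀ ^ 2 * r ^ 2 = -(Kb + Kc)) :
    u₀ ^ 2 * r ^ 2 = Ka - Kb - Kc := by
  linear_combination N2 - (ω ^ 2 + u₀ ^ 2 + r ^ 2) * hω' + hω

/-- Type `{ω, ω', u₀, r}` — the first norm condition `(ω ω' u₀ r)² = K_b K_c` then reads
`-K_a (u₀² r²) = K_b K_c`. -/
theorem three_constants_type_e4 {ω ω' u₀ r Ka Kb Kc : F} (hω : ω ^ 4 = Ka) (hω' : ω' ^ 2 = -ω ^ 2)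
    (N1 : (ω * ω' * u₀ * r) ^ 2 = Kb * Kc) :
    -Ka * (u₀ ^ 2 * r ^ 2) = Kb * Kc := by
  linear_combination N1 + (u₀ ^ 2 * r ^ 2) * hω - (ω ^ 2 * u₀ ^ 2 * r ^ 2) * hω'

/-- Type `{ω, ω', u₀, r}` is EXCLUDED: the two norm conditions force `(K_a - K_b)(K_a - K_c) = 0`. -/
theorem three_constants_type_excluded {ω ω' u₀ r Ka Kb Kc : F} (hω : ω ^ 4 = Ka)
    (hω' : ω' ^ 2 = -ω ^ 2) (N1 : (ω * ω' * u₀ * r) ^ 2 = Kb * Kc)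
    (N2 : ω ^ 2 * ω' ^ 2 + ω ^ 2 * u₀ ^ 2 + ω ^ 2 * r ^ 2 + ω' ^ 2 * u₀ ^ 2 + ω' ^ 2 * r ^ 2
      + u₀ ^ 2 * r ^ 2 = -(Kb + Kc)) :
    (Ka - Kb) * (Ka - Kc) = 0 := by
  have hA := three_constants_type_e2 hω hω' N2
  have hB := three_constants_type_e4 hω hω' N1
  linear_combination -Ka * hA - hB

/-- Hence, for pairwise distinct parameters, no `{ω, ω', u₀, r}` type exists. -/
theorem three_constants_type_false {ω ω' u₀ r Ka Kb Kc : F} (hab : Ka ≠ Kb) (hac : Ka ≠ Kc)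
    (hω : ω ^ 4 = Ka) (hω' : ω' ^ 2 = -ω ^ 2) (N1 : (ω * ω' * u₀ * r) ^ 2 = Kb * Kc)
    (N2 : ω ^ 2 * ω' ^ 2 + ω ^ 2 * u₀ ^ 2 + ω ^ 2 * r ^ 2 + ω' ^ 2 * u₀ ^ 2 + ω' ^ 2 * r ^ 2
      + u₀ ^ 2 * r ^ 2 = -(Kb + Kc)) : False := by
  have h := three_constants_type_excluded hω hω' N1 N2
  rcases mul_eq_zero.mp h with h | h
  · exact hab (sub_eq_zero.mp h)
  · exact hac (sub_eq_zero.mp h)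

end EscapeLocusClosedForm

end Summit.Ventures.HSemireg
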